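import Literature.Probability.RandomPlanarGeometry.SAWFiniteMemoryKernel
import HarnessLib

/-!
# Kernel certificates for `μ(ℤ²)` with TRIE-keyed weight tables (memory `K ≥ 10`)

Topic `Literature/Probability/RandomPlanarGeometry` (continues `SAWFiniteMemoryKernel.lean`). The
association-list certificate `verifyL` costs one linear scan of the table per successor lookup, which
limits the kernel (`decide +kernel`) to the memory-8 automaton (`569` states). Here the weight table is a
4-ary TRIE keyed by the step word (`WTrie`, lookup `O(|a|)`), with the same verifier shape and the same
soundness statement (`WordAutomaton.Certificate (ptStep K)` on the states of positive weight), so that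
the memory-10/12 automata (`2885` / `≈ 15 000` states; Pönitz–Tittmann Table 2: `2.7248`, `2.7113`)
are within reach of the kernel. The states to check are the trie's own nodes of positive weight
(structural traversal `verifyNodes`), so the data file is the trie literal alone.

* `WTrie`, `WTrie.find` — the trie and its lookup;
* `verifyT K N D t` — root weight in `[1, 2⁴¹]` and `verifyStateT` at every node of positive weight;
* `certificate_of_verifyT`, `count_mul_pow_le_of_verifyT`, **`connectiveConstant_le_of_verifyT`**.

## References

* [PonitzTittmann2000] A. Pönitz, P. Tittmann, *Improved upper bounds for self-avoiding walks in ℤᵈ*,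
  Electron. J. Combin. 7 (2000) R21, §2–3 and Table 2.
-/

open Finset Filter Topology Literature.Probability.LatticeModels
open scoped BigOperators

namespace Literature.Probability.RandomPlanarGeometry.SAW

namespace FiniteMemory

/-! ### The trie -/

/-- A 4-ary trie of natural-number weights keyed by step words (`Step = Fin 4`): `node w c₀ c₁ c₂ c₃`
carries the weight `w` of the word ending here and the sub-tries for the next letter.
[cite: PonitzTittmann2000, §3 (the eigenvector, tabulated by state)] -/
inductive WTrie : Type
  | nil : WTrie
  | node : ℕ → WTrie → WTrie → WTrie → WTrie → WTrie

namespace WTrie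

/-- The sub-trie for the letter `d`. [folklore] -/
def child (c₀ c₁ c₂ c₃ : WTrie) (d : Step) : WTrie :=
  if d = 0 then c₀ else if d = 1 then c₁ else if d = 2 then c₂ else c₃

/-- Lookup of the weight of a word (`0` if absent). [cite: PonitzTittmann2000, §3] -/
def find : WTrie → List Step → ℕ
  | nil, _ => 0
  | node w _ _ _ _, [] => w
  | node _ c₀ c₁ c₂ c₃, d :: a => find (child c₀ c₁ c₂ c₃ d) a

/-- `find` on a `node` at a non-empty word descends to the child. [folklore] -/
private theorem find_node_cons (w : ℕ) (c₀ c₁ c₂ c₃ : WTrie) (d : Step) (a : List Step) :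
    find (node w c₀ c₁ c₂ c₃) (d :: a) = find (child c₀ c₁ c₂ c₃ d) a := rfl

end WTrie

/-! ### The verifier -/

/-- Check of one state `a` against the weight trie `t`: positive weight, successors of positive
weight, Collatz–Wielandt inequality. [cite: PonitzTittmann2000, §3] -/
def verifyStateT (K N D : ℕ) (t : WTrie) (a : List Step) : Bool :=
  decide (1 ≤ t.find a) &&
    (List.finRange 4).all (fun d =>
      match ptStep K a d with
      | none => true
      | some b => decide (1 ≤ t.find b)) &&
    decide (D * ((List.finRange 4).map fun d => ((ptStep K a d).map t.find).getD 0).sum ≤ N * t.find a)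

/-- Structural traversal of the trie: every node of positive weight, at the word `pre.reverse`,
passes `verifyStateT` against the whole trie `root`. [cite: PonitzTittmann2000, §3] -/
def verifyNodes (K N D : ℕ) (root : WTrie) : WTrie → List Step → Bool
  | WTrie.nil, _ => true
  | WTrie.node w c₀ c₁ c₂ c₃, pre =>
    (decide (w = 0) || verifyStateT K N D root pre.reverse) &&
      verifyNodes K N D root c₀ ((0 : Step) :: pre) && verifyNodes K N D root c₁ ((1 : Step) :: pre) &&
      verifyNodes K N D root c₂ ((2 : Step) :: pre) && verifyNodes K N D root c₃ ((3 : Step) :: pre)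

/-- Soundness of the traversal: a word `pre.reverse ++ a` of positive weight in the sub-trie `t`
passes the state check. [folklore] -/
private theorem verifyStateT_of_verifyNodes {K N D : ℕ} {root : WTrie} :
    ∀ (t : WTrie) (pre a : List Step), verifyNodes K N D root t pre = true → 1 ≤ t.find a →
      verifyStateT K N D root (pre.reverse ++ a) = true
  | WTrie.nil, pre, a, _, h => by simp [WTrie.find] at h
  | WTrie.node w c₀ c₁ c₂ c₃, pre, [], hc, h => by
    simp only [verifyNodes, Bool.and_eq_true, Bool.or_eq_true, decide_eq_true_eq] at hc
    simp only [WTrie.find] at h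
    rcases hc.1.1.1.1 with h0 | hv
    · omega
    · simpa using hv
  | WTrie.node w c₀ c₁ c₂ c₃, pre, d :: a, hc, h => by
    simp only [verifyNodes, Bool.and_eq_true] at hc
    obtain ⟨⟨⟨⟨-, h0⟩, h1⟩, h2⟩, h3⟩ := hc
    rw [WTrie.find_node_cons] at h
    have key : ∀ (c : WTrie), verifyNodes K N D root c (d :: pre) = true →
        WTrie.find c a = WTrie.find (WTrie.child c₀ c₁ c₂ c₃ d) a →
        verifyStateT K N D root (pre.reverse ++ d :: a) = true := by
      intro c hcov he
      have := verifyStateT_of_verifyNodes c (d :: pre) a hcov (by rw [he]; exact h)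
      simpa using this
    fin_cases d
    · exact key c₀ h0 rfl
    · exact key c₁ h1 rfl
    · exact key c₂ h2 rfl
    · exact key c₃ h3 rfl

/-- **The trie certificate check**: root weight in `[1, 2⁴¹]` and every node of positive weight
passes `verifyStateT`. Evaluated by `decide +kernel` in the data files. [cite: PonitzTittmann2000, §3] -/
def verifyT (K N D : ℕ) (t : WTrie) : Bool :=
  decide (1 ≤ t.find []) && decide (t.find [] ≤ 2 ^ 41) && verifyNodes K N D t t []

/-- **Soundness of `verifyT`**: a Collatz–Wielandt certificate for `ptStep K` on the words of
positive weight, root weight `≤ 2⁴¹`. [cite: PonitzTittmann2000, §3] -/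
theorem certificate_of_verifyT {K N D : ℕ} {t : WTrie} (h : verifyT K N D t = true) :
    WordAutomaton.Certificate (ptStep K) {a | 1 ≤ t.find a} t.find N D ∧ t.find [] ≤ 2 ^ 41 := by
  simp only [verifyT, Bool.and_eq_true, decide_eq_true_eq] at h
  obtain ⟨⟨h0, hroot⟩, hnodes⟩ := h
  have key : ∀ a : List Step, 1 ≤ t.find a →
      (∀ d b, ptStep K a d = some b → 1 ≤ t.find b) ∧
      D * ∑ d : Step, ((ptStep K a d).map t.find).getD 0 ≤ N * t.find a := by
    intro a ha
    have hs : verifyStateT K N D t a = true := by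
      have := verifyStateT_of_verifyNodes t [] a hnodes ha
      simpa using this
    simp only [verifyStateT, Bool.and_eq_true, decide_eq_true_eq, List.all_eq_true] at hs
    obtain ⟨⟨-, hsucc⟩, hcw⟩ := hs
    refine ⟨fun d b hb => ?_, ?_⟩
    · have := hsucc d (List.mem_finRange d)
      rw [hb] at this
      simpa using this
    · have e : ((List.finRange 4).map fun d => ((ptStep K a d).map t.find).getD 0).sum =
          ∑ d : Step, ((ptStep K a d).map t.find).getD 0 := by
        rw [← List.sum_ofFn, List.ofFn_eq_map]
      rw [← e]
      exact hcw
  refine ⟨⟨h0, ?_, ?_, ?_⟩, hroot⟩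
  · intro a ha d b hb
    exact (key a ha).1 d b hb
  · intro a ha
    exact ha
  · intro a ha
    exact (key a ha).2

/-- `cₙ · Dⁿ ≤ Nⁿ · 2⁴¹` from a successful trie certificate check. [cite: PonitzTittmann2000, §3] -/
theorem count_mul_pow_le_of_verifyT {K N D : ℕ} {t : WTrie} (h : verifyT K N D t = true) (n : ℕ) :
    count n * D ^ n ≤ N ^ n * 2 ^ 41 := by
  obtain ⟨hc, hroot⟩ := certificate_of_verifyT h
  exact le_trans (WordAutomaton.count_mul_pow_le hc (run_ne_none_of_isSAW K) n)
    (Nat.mul_le_mul_left _ hroot)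

/-- **`μ(ℤ²) ≤ N/D` from a successful trie certificate check (kernel).** [cite: PonitzTittmann2000, §3 and Table 2] -/
theorem connectiveConstant_le_of_verifyT {K N D : ℕ} {t : WTrie} (h : verifyT K N D t = true)
    (hD : 0 < D) : connectiveConstant ≤ (N : ℝ) / D :=
  connectiveConstant_le_of_count_bound (count_mul_pow_le_of_verifyT h) hD

end FiniteMemory

end Literature.Probability.RandomPlanarGeometry.SAW
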